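import Mathlib.Analysis.Complex.Convex
import Mathlib.Analysis.Normed.Affine.Convex
import Mathlib.Topology.MetricSpace.Thickening
import Mathlib.Analysis.Complex.ReImTopology
import Mathlib.Analysis.LocallyConvex.WithSeminorms
import Mathlib.Topology.Connected.LocallyPathConnected
import Mathlib.Topology.Connected.TotallyDisconnected
import Mathlib.MeasureTheory.Measure.Lebesgue.Complex
import Mathlib.MeasureTheory.Measure.Lebesgue.EqHaar
import Mathlib.MeasureTheory.Measure.Real
import Mathlib.LinearAlgebra.Complex.FiniteDimensional
import Literature.Probability.LatticeModels.DomainDiscretisation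
import Literature.Probability.RandomPlanarGeometry.PlanarDomains
import HarnessLib

/-!
# The largest mesh component is the bulk (domains with Lebesgue-null boundary)

Topic: Probability / LatticeModels (companion to `DomainDiscretisation.lean`). H21 discretises a
planar domain `Ω` at mesh `δ` by `meshDomain Ω δ`: the union of the connected components *of
maximal cardinality* of the mesh graph on `Ω ∩ δℤ²` (vertices: lattice points with mesh point in
`Ω`; edges: nearest neighbours whose closed segment lies in `Ω̄`), following Smirnov's wording
"the largest connected component of `Ω ∩ δℤ²`" (Smirnov 2001, §2; Chelkak–Smirnov 2012, §1.2).
Scaling-limit arguments (RSW/FKG chaining for crossing probabilities, discrete holomorphicity)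
take place in the *bulk*: the component containing the lattice points of a fixed compact
`K ⊆ Ω`. This file proves that the two agree for small mesh **provided `∂Ω` is Lebesgue-null**:

* `exists_forall_mem_meshDomain_and_reachable`: if `Ω` is open, bounded, connected and
  `volume (frontier Ω) = 0`, then for every compact `K ⊆ Ω` there is `δ₀ > 0` such that for
  `0 < δ < δ₀` every lattice point with mesh point in `K` lies in `meshDomain Ω δ`, and
  `meshDomain Ω δ` is one connected component of the mesh graph (`eventually_…` for the
  `𝓝[>] 0` phrasing, `JordanDomain.…` for `Literature.Probability.RandomPlanarGeometry.JordanDomain`s with null boundary curve).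

Why the proviso. Lattice-point counts of open sets are not controlled by area, and for a
Jordan curve of positive area (Osgood curves) it is not clear — and not treated in any source we
know — whether a boundary-hugging component can outnumber the bulk along a sequence of meshes;
under `volume (frontier Ω) = 0` the elementary counting below settles it. This is the lemma
behind the null-boundary proviso in the corrected form of the RSW corollary
`Literature.Probability.Percolation.discreteCrossingProb_clusterPt_mem_Ioo` (`Percolation/BoxCrossing.lean`), whose
folklore proof (RSW box crossings chained inside `Ω`, FKG) produces open paths in the bulk.

Proof outline (all elementary; no source states it, we record it as folklore):
1. *Bulk neighbourhood* (`exists_isOpen_isPreconnected_bulk`): `K` lies in an open preconnected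
   `V ⊆ Ω` whose points are at distance `> ρ > 0` from `Ωᶜ` (components of a base point in
   `{ρ < infDist · Ωᶜ}` exhaust the path-connected `Ω`; compactness).
2. *Staircase lemma* (`meshVertexGraph_reachable_of_rectangle_subset`): lattice points spanning
   a rectangle inside `Ω` are joined in the mesh graph; hence (`…_of_mem_bulk`) the component of
   the lattice point nearest to `w` is locally constant in `w ∈ V`, so constant (`V`
   preconnected): all lattice points of `V` lie in one component `B`, for `3δ ≤ ρ`.
3. *Counting* (`volume_real_le_ncard_mul`, `ncard_mul_le_volume_real`): closed `δ`-balls about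
   the lattice points at distance `≥ ε` from `Ωᶜ` cover `{2ε ≤ infDist · Ωᶜ}`, of area
   `≥ area Ω − o(1)`; disjoint open `δ/2`-balls about the remaining mesh vertices fit into
   (inner collar of width `ε + δ`) ∪ `∂Ω` ∪ (outer collar of width `δ`), of area `o(1)` as
   `ε, δ → 0` (`exists_pos_volume_real_innerCollar_lt`, `…outerCollar_lt`: the collars decrease
   to `∅`) plus `area ∂Ω = 0`. So every component other than `B` is strictly smaller than `B`,
   and `meshDomain Ω δ` is exactly the vertex set of `B`.

Mathlib anchors: `Rectangle`, `Set.uIcc`, `Convex.segment_subset`, `connectedComponentIn`,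
`IsPreconnected.constant`, `JoinedIn.somePath`, `IsCompact.elim_directed_cover`,
`Metric.infDist`, `Metric.thickening`, `MeasureTheory.tendsto_measure_iInter_atTop`,
`Measure.addHaar_real_closedBall`, `measureReal_biUnion_finset(_le)`, `Set.ncard`,
`SimpleGraph.ConnectedComponent.supp`.

## References
* S. Smirnov, *Critical percolation in the plane*, C. R. Acad. Sci. Paris 333 (2001), §2
  ("largest connected component") [Smirnov2001].
* D. Chelkak, S. Smirnov, *Universality in the 2D Ising model and conformal invariance of
  fermionic observables*, Invent. Math. 189 (2012), §1.2 [ChelkakSmirnov2012].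
-/

namespace Literature.Probability.LatticeModels

open Set Metric MeasureTheory Filter Topology Complex

noncomputable section

/-! ### Rectangles spanned by two mesh points -/

/-- The axis-parallel rectangle with opposite corners `z`, `w` is convex. [folklore] -/
theorem convex_rectangle (z w : ℂ) : Convex ℝ (Rectangle z w) := by
  rw [rectangle_eq_convexHull]
  exact convex_convexHull ℝ _

/-- Both corners belong to the rectangle they span. [folklore] -/
theorem left_mem_rectangle (z w : ℂ) : z ∈ Rectangle z w :=
  ⟨left_mem_uIcc, left_mem_uIcc⟩

/-- Both corners belong to the rectangle they span. [folklore] -/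
theorem right_mem_rectangle (z w : ℂ) : w ∈ Rectangle z w :=
  ⟨right_mem_uIcc, right_mem_uIcc⟩

/-- A rectangle with one corner moved inside shrinks. [folklore] -/
theorem rectangle_subset_of_mem {z z' w : ℂ} (hz' : z' ∈ Rectangle z w) :
    Rectangle z' w ⊆ Rectangle z w := fun _ hp =>
  ⟨uIcc_subset_uIcc hz'.1 right_mem_uIcc hp.1, uIcc_subset_uIcc hz'.2 right_mem_uIcc hp.2⟩

/-- A point of `[[a, b]]` is no farther from `c` than the farther of `a`, `b`. [folklore] -/
theorem abs_sub_le_max_of_mem_uIcc {a b c p : ℝ} (hp : p ∈ uIcc a b) :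
    |p - c| ≤ max |a - c| |b - c| := by
  rcases mem_uIcc.1 hp with ⟨h1, h2⟩ | ⟨h1, h2⟩
  · rcases le_total p c with hpc | hpc
    · rw [abs_of_nonpos (sub_nonpos.2 hpc)]
      exact le_max_of_le_left ((abs_sub_comm c a ▸ le_abs_self (c - a)).trans' (by linarith))
    · rw [abs_of_nonneg (sub_nonneg.2 hpc)]
      exact le_max_of_le_right ((le_abs_self (b - c)).trans' (by linarith))
  · rcases le_total p c with hpc | hpc
    · rw [abs_of_nonpos (sub_nonpos.2 hpc)]
      exact le_max_of_le_right ((abs_sub_comm c b ▸ le_abs_self (c - b)).trans' (by linarith))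
    · rw [abs_of_nonneg (sub_nonneg.2 hpc)]
      exact le_max_of_le_left ((le_abs_self (a - c)).trans' (by linarith))

/-- A rectangle whose corners are within `r` of `c` lies in the ball of radius `2r` about `c`
(crude, via `‖p‖ ≤ |re p| + |im p|`). [folklore] -/
theorem rectangle_subset_ball {z w c : ℂ} {r : ℝ} (hz : dist z c < r) (hw : dist w c < r) :
    Rectangle z w ⊆ ball c (2 * r) := by
  intro p hp
  rw [mem_ball, Complex.dist_eq]
  have hre := abs_sub_le_max_of_mem_uIcc (c := c.re) hp.1
  have him := abs_sub_le_max_of_mem_uIcc (c := c.im) hp.2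
  have h1 : |z.re - c.re| < r := (abs_re_le_norm (z - c)).trans_lt (by rwa [← Complex.dist_eq])
  have h2 : |w.re - c.re| < r := (abs_re_le_norm (w - c)).trans_lt (by rwa [← Complex.dist_eq])
  have h3 : |z.im - c.im| < r := (abs_im_le_norm (z - c)).trans_lt (by rwa [← Complex.dist_eq])
  have h4 : |w.im - c.im| < r := (abs_im_le_norm (w - c)).trans_lt (by rwa [← Complex.dist_eq])
  calc ‖p - c‖ ≤ |(p - c).re| + |(p - c).im| := norm_le_abs_re_add_abs_im _
    _ = |p.re - c.re| + |p.im - c.im| := by simp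
    _ < r + r := add_lt_add (hre.trans_lt (max_lt h1 h2)) (him.trans_lt (max_lt h3 h4))
    _ = 2 * r := by ring

/-! ### Staircase paths: lattice points of a rectangle inside `Ω` are joined in the mesh graph -/

/-- One lattice step `a ↦ a + s eᵢ` (`s = ±1`) is an edge of `ℤ²`. [folklore] -/
theorem zdGraph_adj_add_single (a : Site 2) (i : Fin 2) {s : ℤ} (hs : s = 1 ∨ s = -1) :
    (zdGraph 2).Adj a (a + Pi.single i s) := by
  rw [zdGraph_adj_iff]
  rcases hs with rfl | rfl
  · exact ⟨i, Or.inl rfl⟩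
  · refine ⟨i, Or.inr ?_⟩
    rw [add_assoc, ← Pi.single_add]
    simp

/-- Scaling by `δ ≥ 0` maps `[[p, r]] ∩ ℤ` into `[[δ p, δ r]]`. [folklore] -/
theorem mul_cast_mem_uIcc {δ : ℝ} (hδ : 0 ≤ δ) {p q r : ℤ} (h : q ∈ uIcc p r) :
    δ * (q : ℝ) ∈ uIcc (δ * (p : ℝ)) (δ * (r : ℝ)) := by
  rcases mem_uIcc.1 h with ⟨h1, h2⟩ | ⟨h1, h2⟩
  · exact mem_uIcc.2 (Or.inl ⟨mul_le_mul_of_nonneg_left (by exact_mod_cast h1) hδ,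
      mul_le_mul_of_nonneg_left (by exact_mod_cast h2) hδ⟩)
  · exact mem_uIcc.2 (Or.inr ⟨mul_le_mul_of_nonneg_left (by exact_mod_cast h1) hδ,
      mul_le_mul_of_nonneg_left (by exact_mod_cast h2) hδ⟩)

/-- A lattice point lying coordinatewise between `a` and `b` has its mesh point in the rectangle
spanned by the mesh points of `a` and `b`. [folklore] -/
theorem meshPoint_mem_rectangle {δ : ℝ} (hδ : 0 ≤ δ) {a b x : Site 2}
    (h : ∀ j, x j ∈ uIcc (a j) (b j)) :
    meshPoint δ x ∈ Rectangle (meshPoint δ a) (meshPoint δ b) := by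
  simp only [Rectangle, mem_reProdIm, meshPoint_re, meshPoint_im]
  exact ⟨mul_cast_mem_uIcc hδ (h 0), mul_cast_mem_uIcc hδ (h 1)⟩

/-- **Staircase lemma.** If the closed rectangle spanned by the mesh points of two lattice points
`a`, `b` lies in `Ω`, then `a` and `b` are joined in the mesh graph of `Ω` on mesh vertices (by a
monotone lattice staircase inside the rectangle, whose closed edges lie in `Ω ⊆ Ω̄`). [folklore] -/
theorem meshVertexGraph_reachable_of_rectangle_subset {Ω : Set ℂ} {δ : ℝ} (hδ : 0 < δ) :
    ∀ (n : ℕ) (a b : Site 2), (b 0 - a 0).natAbs + (b 1 - a 1).natAbs = n →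
      Rectangle (meshPoint δ a) (meshPoint δ b) ⊆ Ω →
      ∀ (ha : a ∈ meshVertices Ω δ) (hb : b ∈ meshVertices Ω δ),
        (meshVertexGraph Ω δ).Reachable ⟨a, ha⟩ ⟨b, hb⟩ := by
  intro n
  induction n with
  | zero =>
    intro a b hn hR ha hb
    have hab : a = b := by
      ext j; fin_cases j <;> simp <;> omega
    subst hab
    rfl
  | succ n ih =>
    intro a b hn hR ha hb
    -- choose a coordinate `i` in which `a` and `b` differ, and the sign `s` pointing to `b`
    obtain ⟨i, hi⟩ : ∃ i : Fin 2, a i ≠ b i := by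
      by_contra! h
      have h0 := h 0; have h1 := h 1
      omega
    set s : ℤ := if a i < b i then 1 else -1 with hs_def
    have hs : s = 1 ∨ s = -1 := by rw [hs_def]; split_ifs <;> simp
    set a' : Site 2 := a + Pi.single i s with ha'_def
    have ha'j : ∀ j, a' j = a j + if j = i then s else 0 := fun j => by
      rw [ha'_def, Pi.add_apply, Pi.single_apply]
    -- `a'` lies coordinatewise between `a` and `b`
    have hbetween : ∀ j, a' j ∈ uIcc (a j) (b j) := by
      intro j
      rw [ha'j j, mem_uIcc]
      by_cases hji : j = i
      · subst hji
        rw [if_pos rfl, hs_def]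
        split_ifs with hlt
        · left; constructor <;> omega
        · right; constructor <;> omega
      · rw [if_neg hji, add_zero]
        rcases le_total (a j) (b j) with h | h
        · exact Or.inl ⟨le_rfl, h⟩
        · exact Or.inr ⟨h, le_rfl⟩
    have hmemR : meshPoint δ a' ∈ Rectangle (meshPoint δ a) (meshPoint δ b) :=
      meshPoint_mem_rectangle hδ.le hbetween
    have hR' : Rectangle (meshPoint δ a') (meshPoint δ b) ⊆ Ω :=
      (rectangle_subset_of_mem hmemR).trans hR
    have ha'Ω : a' ∈ meshVertices Ω δ := hR hmemR
    -- the lattice distance to `b` has dropped by one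
    have hsgn : (a i < b i ∧ s = 1) ∨ (b i < a i ∧ s = -1) := by
      rw [hs_def]
      split_ifs with h
      · exact Or.inl ⟨h, rfl⟩
      · exact Or.inr ⟨lt_of_le_of_ne (not_lt.1 h) (Ne.symm hi), rfl⟩
    have hn' : (b 0 - a' 0).natAbs + (b 1 - a' 1).natAbs = n := by
      have h0 := ha'j 0
      have h1 := ha'j 1
      fin_cases i
      · simp only [Fin.zero_eta, Fin.isValue, ↓reduceIte, one_ne_zero] at h0 h1 hsgn
        rw [h0, h1]
        omega
      · simp only [Fin.mk_one, Fin.isValue, zero_ne_one, ↓reduceIte] at h0 h1 hsgn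
        rw [h0, h1]
        omega
    -- the step `a → a'` is a mesh edge (its closed segment lies in the rectangle, inside `Ω`)
    have hadj : (meshVertexGraph Ω δ).Adj ⟨a, ha⟩ ⟨a', ha'Ω⟩ := by
      show (meshGraph Ω δ).Adj a a'
      refine meshGraph_adj_iff.2 ⟨zdGraph_adj_add_single a i hs, ?_⟩
      exact ((convex_rectangle _ _).segment_subset (left_mem_rectangle _ _) hmemR).trans
        (hR.trans subset_closure)
    exact hadj.reachable.trans (ih a' b hn' hR' ha'Ω hb)
/-! ### The bulk: an open connected neighbourhood of a compact set, uniformly inside `Ω` -/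

/-- A compact set disjoint from a nonempty closed set is at positive distance from it, in the
`infDist` form. [folklore] -/
theorem exists_pos_forall_lt_infDist {S T : Set ℂ} (hS : IsCompact S) (hT : IsClosed T)
    (hST : Disjoint S T) (hTne : T.Nonempty) : ∃ r > 0, ∀ w ∈ S, r < infDist w T := by
  rcases S.eq_empty_or_nonempty with rfl | hSne
  · exact ⟨1, one_pos, fun w hw => hw.elim⟩
  obtain ⟨w₀, hw₀S, hw₀⟩ := hS.exists_isMinOn hSne (continuous_infDist_pt T).continuousOn
  have hpos : 0 < infDist w₀ T := by
    rw [← hT.closure_eq] at hST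
    exact (infDist_pos_iff_notMem_closure hTne).1 (Set.disjoint_left.1 hST hw₀S ∘ fun h => by
      rwa [hT.closure_eq] at h ⊢)
  refine ⟨infDist w₀ T / 2, by positivity, fun w hw => ?_⟩
  have := hw₀ hw
  simp only [mem_setOf_eq] at this
  linarith

/-- **The bulk neighbourhood.** For a compact subset `K` of an open connected set `Ω ≠ ℂ` there
is an open preconnected set `V` with `K ⊆ V ⊆ Ω`, all of whose points are at distance more than
some `ρ > 0` from `Ωᶜ`. (Take the component of a base point in `{w | ρ < infDist w Ωᶜ}`; these
components increase as `ρ ↓ 0` and exhaust `Ω` because `Ω` is path connected, so one of them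
contains `K` by compactness.) [folklore] -/
theorem exists_isOpen_isPreconnected_bulk {Ω K : Set ℂ} (hΩo : IsOpen Ω) (hΩc : IsConnected Ω)
    (hne : Ωᶜ.Nonempty) (hK : IsCompact K) (hKΩ : K ⊆ Ω) :
    ∃ V : Set ℂ, IsOpen V ∧ IsPreconnected V ∧ K ⊆ V ∧ V.Nonempty ∧
      ∃ ρ > 0, ∀ w ∈ V, ρ < infDist w Ωᶜ := by
  obtain ⟨z₀, hz₀⟩ := hΩc.nonempty
  let U : ℝ → Set ℂ := fun r => {w | r < infDist w Ωᶜ}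
  have hUo : ∀ r, IsOpen (U r) := fun r => isOpen_lt continuous_const (continuous_infDist_pt _)
  have hUanti : ∀ r r', r ≤ r' → U r' ⊆ U r := fun _ _ h w hw => lt_of_le_of_lt h hw
  let V : ℕ → Set ℂ := fun n => connectedComponentIn (U (1 / (n + 1))) z₀
  have hVo : ∀ n, IsOpen (V n) := fun n => (hUo _).connectedComponentIn
  have hVmono : Monotone V := by
    intro n m hnm
    refine connectedComponentIn_mono z₀ (hUanti _ _ ?_)
    exact one_div_le_one_div_of_le (by positivity) (by exact_mod_cast Nat.succ_le_succ hnm)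
  -- every point of `Ω` lies in some `V n` (path to `z₀`, at positive distance from `Ωᶜ`)
  have hcover : ∀ z ∈ Ω, ∃ n, z ∈ V n := by
    intro z hz
    have hj : JoinedIn Ω z₀ z :=
      ((hΩo.isConnected_iff_isPathConnected).1 hΩc).joinedIn z₀ hz₀ z hz
    set γ := hj.somePath
    have hSc : IsCompact (range γ) := isCompact_range γ.continuous
    have hSΩ : range γ ⊆ Ω := by
      rintro _ ⟨t, rfl⟩
      exact hj.somePath_mem t
    obtain ⟨r, hr, hrS⟩ := exists_pos_forall_lt_infDist hSc hΩo.isClosed_compl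
      (disjoint_compl_right_iff_subset.2 hSΩ) hne
    obtain ⟨n, hn⟩ := exists_nat_one_div_lt hr
    refine ⟨n, (isPreconnected_range γ.continuous).subset_connectedComponentIn ⟨0, γ.source⟩
      (fun w hw => hn.trans (hrS w hw)) ⟨1, γ.target⟩⟩
  obtain ⟨n, hn⟩ := hK.elim_directed_cover V hVo
    (fun z hz => mem_iUnion.2 (hcover z (hKΩ hz))) hVmono.directed_le
  -- make sure the base point itself qualifies
  have hz₀pos : 0 < infDist z₀ Ωᶜ :=
    (infDist_pos_iff_notMem_closure hne).1 (by rw [hΩo.isClosed_compl.closure_eq]; exact fun h => h hz₀)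
  obtain ⟨n₁, hn₁⟩ := exists_nat_one_div_lt hz₀pos
  set N := max n n₁ with hN
  have hz₀U : z₀ ∈ U (1 / (N + 1)) := by
    refine lt_of_le_of_lt ?_ hn₁
    exact one_div_le_one_div_of_le (by positivity) (by exact_mod_cast Nat.succ_le_succ (le_max_right n n₁))
  refine ⟨V N, hVo N, isPreconnected_connectedComponentIn, hn.trans (hVmono (le_max_left _ _)),
    ⟨z₀, mem_connectedComponentIn hz₀U⟩, 1 / (N + 1), by positivity, fun w hw => ?_⟩
  exact (connectedComponentIn_subset _ _ hw : w ∈ U (1 / (N + 1)))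

/-! ### All lattice points of the bulk lie in one mesh component -/

/-- **One component.** If `V` is preconnected and every ball of radius `ρ ≥ 3δ` about a point
of `V` lies in `Ω`, then any two lattice points whose mesh points lie in `V` are joined in the
mesh graph of `Ω` on mesh vertices. (The component of the lattice point nearest to `w` is a
locally constant function of `w ∈ V`, by the staircase lemma in a rectangle of size `O(δ)`.)
[folklore] -/
theorem meshVertexGraph_reachable_of_mem_bulk {Ω V : Set ℂ} {δ ρ : ℝ} (hδ : 0 < δ)
    (hδρ : 3 * δ ≤ ρ) (hV : IsPreconnected V) (hVΩ : ∀ w ∈ V, ball w ρ ⊆ Ω) {x y : Site 2}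
    (hx : meshPoint δ x ∈ V) (hy : meshPoint δ y ∈ V) :
    ∃ (hx' : x ∈ meshVertices Ω δ) (hy' : y ∈ meshVertices Ω δ),
      (meshVertexGraph Ω δ).Reachable ⟨x, hx'⟩ ⟨y, hy'⟩ := by
  classical
  set G := meshVertexGraph Ω δ
  let compOf : Site 2 → Option G.ConnectedComponent := fun v =>
    if h : v ∈ meshVertices Ω δ then some (G.connectedComponentMk ⟨v, h⟩) else none
  let f : ℂ → Option G.ConnectedComponent := fun w => compOf (nearestSite δ w)
  letI : TopologicalSpace (Option G.ConnectedComponent) := ⊥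
  haveI : DiscreteTopology (Option G.ConnectedComponent) := ⟨rfl⟩
  -- `f` is constant on the ball of radius `δ / 4` about any point of `V`
  have key : ∀ z ∈ V, ∀ w, dist w z < δ / 4 → f w = f z := by
    intro z hz w hw
    have h1 : dist (meshPoint δ (nearestSite δ z)) z < 5 / 4 * δ :=
      (dist_meshPoint_nearestSite_le hδ z).trans_lt (by linarith)
    have h2 : dist (meshPoint δ (nearestSite δ w)) z < 5 / 4 * δ :=
      calc dist (meshPoint δ (nearestSite δ w)) z
          ≤ dist (meshPoint δ (nearestSite δ w)) w + dist w z := dist_triangle _ _ _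
        _ < δ + δ / 4 := add_lt_add_of_le_of_lt (dist_meshPoint_nearestSite_le hδ w) hw
        _ = 5 / 4 * δ := by ring
    have hR : Rectangle (meshPoint δ (nearestSite δ w)) (meshPoint δ (nearestSite δ z)) ⊆ Ω :=
      (rectangle_subset_ball h2 h1).trans ((ball_subset_ball (by linarith)).trans (hVΩ z hz))
    have hnw : nearestSite δ w ∈ meshVertices Ω δ := hR (left_mem_rectangle _ _)
    have hnz : nearestSite δ z ∈ meshVertices Ω δ := hR (right_mem_rectangle _ _)
    have hreach := meshVertexGraph_reachable_of_rectangle_subset hδ _ _ _ rfl hR hnw hnz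
    show compOf (nearestSite δ w) = compOf (nearestSite δ z)
    simp only [compOf, dif_pos hnw, dif_pos hnz]
    exact congrArg some (SimpleGraph.ConnectedComponent.sound hreach)
  have hcont : ContinuousOn f V := by
    intro z hz
    refine ContinuousAt.continuousWithinAt ((continuousAt_const (y := f z)).congr ?_)
    filter_upwards [ball_mem_nhds z (by positivity : (0 : ℝ) < δ / 4)] with w hw
    exact (key z hz w (mem_ball.1 hw)).symm
  have hfxy := hV.constant hcont hx hy
  have hxΩ : x ∈ meshVertices Ω δ := hVΩ _ hx (mem_ball_self (by linarith))
  have hyΩ : y ∈ meshVertices Ω δ := hVΩ _ hy (mem_ball_self (by linarith))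
  refine ⟨hxΩ, hyΩ, ?_⟩
  have hfx : f (meshPoint δ x) = some (G.connectedComponentMk ⟨x, hxΩ⟩) := by
    show compOf (nearestSite δ (meshPoint δ x)) = _
    rw [nearestSite_meshPoint hδ.ne']
    simp only [compOf, dif_pos hxΩ]
  have hfy : f (meshPoint δ y) = some (G.connectedComponentMk ⟨y, hyΩ⟩) := by
    show compOf (nearestSite δ (meshPoint δ y)) = _
    rw [nearestSite_meshPoint hδ.ne']
    simp only [compOf, dif_pos hyΩ]
  rw [hfx, hfy] at hfxy
  exact SimpleGraph.ConnectedComponent.exact (Option.some_injective _ hfxy)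

/-! ### Collars of the boundary have small area -/

/-- The inner collar `{z ∈ Ω | infDist z Ωᶜ < r}` of a bounded open set has area tending to `0`
with `r` (the collars decrease to `∅`; no hypothesis on `∂Ω`). [folklore] -/
theorem exists_pos_volume_real_innerCollar_lt {Ω : Set ℂ} (hΩo : IsOpen Ω)
    (hΩb : Bornology.IsBounded Ω) (hne : Ωᶜ.Nonempty) {η : ℝ} (hη : 0 < η) :
    ∃ r > 0, volume.real {z ∈ Ω | infDist z Ωᶜ < r} < η := by
  set s : ℕ → Set ℂ := fun n => {z ∈ Ω | infDist z Ωᶜ < 1 / (n + 1)} with hs_def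
  have hsm : ∀ n, NullMeasurableSet (s n) volume := fun n =>
    (hΩo.inter (isOpen_lt (continuous_infDist_pt _) continuous_const)).measurableSet
      |>.nullMeasurableSet
  have hanti : Antitone s := by
    intro n m hnm z hz
    refine ⟨hz.1, hz.2.trans_le ?_⟩
    exact one_div_le_one_div_of_le (by positivity) (by exact_mod_cast Nat.succ_le_succ hnm)
  have hfin : ∃ n, volume (s n) ≠ ⊤ := ⟨0, (hΩb.subset (fun z hz => hz.1)).measure_lt_top.ne⟩
  have hempty : ⋂ n, s n = ∅ := by
    refine eq_empty_of_forall_notMem fun z hz => ?_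
    rw [mem_iInter] at hz
    have hzΩ : z ∈ Ω := (hz 0).1
    have hpos : 0 < infDist z Ωᶜ :=
      (infDist_pos_iff_notMem_closure hne).1 (by rw [hΩo.isClosed_compl.closure_eq]; exact fun h => h hzΩ)
    obtain ⟨n, hn⟩ := exists_nat_one_div_lt hpos
    exact lt_irrefl _ (hn.trans (hz n).2)
  have ht := tendsto_measure_iInter_atTop hsm hanti hfin
  rw [hempty, measure_empty] at ht
  have hev : ∀ᶠ n in atTop, volume (s n) < ENNReal.ofReal η :=
    ht (Iio_mem_nhds (ENNReal.ofReal_pos.2 hη))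
  obtain ⟨n, hn⟩ := hev.exists
  exact ⟨1 / (n + 1), by positivity, ENNReal.toReal_lt_of_lt_ofReal hn⟩

/-- The outer collar `{z ∉ Ω̄ | infDist z ∂Ω < r}` of a bounded set with nonempty frontier has
area tending to `0` with `r`. [folklore] -/
theorem exists_pos_volume_real_outerCollar_lt {Ω : Set ℂ} (hΩb : Bornology.IsBounded Ω)
    (hfne : (frontier Ω).Nonempty) {η : ℝ} (hη : 0 < η) :
    ∃ r > 0, volume.real {z | z ∉ closure Ω ∧ infDist z (frontier Ω) < r} < η := by
  set s : ℕ → Set ℂ := fun n => {z | z ∉ closure Ω ∧ infDist z (frontier Ω) < 1 / (n + 1)}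
    with hs_def
  have hsm : ∀ n, NullMeasurableSet (s n) volume := fun n =>
    (isClosed_closure.isOpen_compl.inter
      (isOpen_lt (continuous_infDist_pt _) continuous_const)).measurableSet.nullMeasurableSet
  have hanti : Antitone s := by
    intro n m hnm z hz
    refine ⟨hz.1, hz.2.trans_le ?_⟩
    exact one_div_le_one_div_of_le (by positivity) (by exact_mod_cast Nat.succ_le_succ hnm)
  have hfin : ∃ n, volume (s n) ≠ ⊤ := by
    have hsub : s 0 ⊆ thickening (1 / ((0 : ℕ) + 1)) (frontier Ω) := fun z hz =>
      (mem_thickening_iff_infDist_lt hfne).2 hz.2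
    exact ⟨0, ((hΩb.closure.subset frontier_subset_closure).thickening.subset hsub).measure_lt_top.ne⟩
  have hempty : ⋂ n, s n = ∅ := by
    refine eq_empty_of_forall_notMem fun z hz => ?_
    rw [mem_iInter] at hz
    have hzΩ : z ∉ closure Ω := (hz 0).1
    have hpos : 0 < infDist z (frontier Ω) := by
      refine (infDist_pos_iff_notMem_closure hfne).1 ?_
      rw [isClosed_frontier.closure_eq]
      exact fun h => hzΩ (frontier_subset_closure h)
    obtain ⟨n, hn⟩ := exists_nat_one_div_lt hpos
    exact lt_irrefl _ (hn.trans (hz n).2)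
  have ht := tendsto_measure_iInter_atTop hsm hanti hfin
  rw [hempty, measure_empty] at ht
  have hev : ∀ᶠ n in atTop, volume (s n) < ENNReal.ofReal η :=
    ht (Iio_mem_nhds (ENNReal.ofReal_pos.2 hη))
  obtain ⟨n, hn⟩ := hev.exists
  exact ⟨1 / (n + 1), by positivity, ENNReal.toReal_lt_of_lt_ofReal hn⟩

/-! ### Counting lattice points against area -/

/-- Distinct lattice points have mesh points at distance at least `δ`. [folklore] -/
theorem le_dist_meshPoint_of_ne {δ : ℝ} (hδ : 0 < δ) {x y : Site 2} (hxy : x ≠ y) :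
    δ ≤ dist (meshPoint δ x) (meshPoint δ y) := by
  obtain ⟨i, hi⟩ : ∃ i, x i ≠ y i := by
    by_contra! h
    exact hxy (funext h)
  have hint : (1 : ℝ) ≤ |((x i : ℝ) - (y i : ℝ))| := by
    rw [← Int.cast_sub, ← Int.cast_abs]
    exact_mod_cast Int.one_le_abs (sub_ne_zero.2 hi)
  have hcoord : δ ≤ |δ * (x i : ℝ) - δ * (y i : ℝ)| := by
    rw [← mul_sub, abs_mul, abs_of_pos hδ]
    nlinarith
  rw [Complex.dist_eq]
  fin_cases i
  · exact hcoord.trans (by simpa using abs_re_le_norm (meshPoint δ x - meshPoint δ y))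
  · exact hcoord.trans (by simpa using abs_im_le_norm (meshPoint δ x - meshPoint δ y))

/-- **Lower count.** The lattice points of `Ω` at distance at least `ε` from `Ωᶜ` are at least
as many as `area {z ∈ Ω | 2ε ≤ infDist z Ωᶜ} / area (B(0, δ))` (for `δ ≤ ε`): the closed
`δ`-balls about them cover that set, each point being within `δ` of its nearest lattice
point. [folklore] -/
theorem volume_real_le_ncard_mul {Ω : Set ℂ} (hΩb : Bornology.IsBounded Ω) {δ ε : ℝ}
    (hδ : 0 < δ) (hδε : δ ≤ ε) :
    volume.real {z ∈ Ω | 2 * ε ≤ infDist z Ωᶜ} ≤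
      ({x : Site 2 | meshPoint δ x ∈ Ω ∧ ε ≤ infDist (meshPoint δ x) Ωᶜ}.ncard : ℝ) *
        (δ ^ 2 * volume.real (ball (0 : ℂ) 1)) := by
  set P : Set (Site 2) := {x | meshPoint δ x ∈ Ω ∧ ε ≤ infDist (meshPoint δ x) Ωᶜ} with hP
  have hPfin : P.Finite := (meshVertices_finite hΩb hδ).subset fun x hx => hx.1
  have hcover : {z ∈ Ω | 2 * ε ≤ infDist z Ωᶜ} ⊆
      ⋃ x ∈ hPfin.toFinset, closedBall (meshPoint δ x) δ := by
    intro z hz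
    have hd : dist (meshPoint δ (nearestSite δ z)) z ≤ δ := dist_meshPoint_nearestSite_le hδ z
    have hn : nearestSite δ z ∈ P := by
      constructor
      · refine ball_infDist_compl_subset (s := Ω) (x := z) (mem_ball.2 ?_)
        linarith [hz.2]
      · have := infDist_le_infDist_add_dist (x := z) (y := meshPoint δ (nearestSite δ z)) (s := Ωᶜ)
        rw [dist_comm] at this
        linarith [hz.2]
    exact mem_biUnion (hPfin.mem_toFinset.2 hn) (mem_closedBall'.2 hd)
  have hfinU : volume (⋃ x ∈ hPfin.toFinset, closedBall (meshPoint δ x) δ) ≠ ⊤ :=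
    ((measure_biUnion_finset_le _ _).trans_lt
      (ENNReal.sum_lt_top.2 fun _ _ => measure_closedBall_lt_top)).ne
  calc volume.real {z ∈ Ω | 2 * ε ≤ infDist z Ωᶜ}
      ≤ volume.real (⋃ x ∈ hPfin.toFinset, closedBall (meshPoint δ x) δ) :=
        measureReal_mono hcover hfinU
    _ ≤ ∑ x ∈ hPfin.toFinset, volume.real (closedBall (meshPoint δ x) δ) :=
        measureReal_biUnion_finset_le _ _
    _ = ∑ x ∈ hPfin.toFinset, δ ^ 2 * volume.real (ball (0 : ℂ) 1) := by
        refine Finset.sum_congr rfl fun x _ => ?_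
        rw [Measure.addHaar_real_closedBall volume _ hδ.le, Complex.finrank_real_complex]
    _ = (P.ncard : ℝ) * (δ ^ 2 * volume.real (ball (0 : ℂ) 1)) := by
        rw [Finset.sum_const, nsmul_eq_mul, Set.ncard_eq_toFinset_card P hPfin]

/-- **Upper count.** The mesh vertices within `ε` of `Ωᶜ` are at most
`(area of the collar of width ε + δ inside, plus ∂Ω, plus the collar of width δ outside) /
area (B(0, δ/2))`: the open `δ/2`-balls about them are pairwise disjoint and lie in that
union. [folklore] -/
theorem ncard_mul_le_volume_real {Ω : Set ℂ} (hΩo : IsOpen Ω) (hΩb : Bornology.IsBounded Ω)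
    (hfne : (frontier Ω).Nonempty) {δ ε : ℝ} (hδ : 0 < δ) :
    ({x ∈ meshVertices Ω δ | infDist (meshPoint δ x) Ωᶜ < ε}.ncard : ℝ) *
        ((δ / 2) ^ 2 * volume.real (ball (0 : ℂ) 1)) ≤
      volume.real {z ∈ Ω | infDist z Ωᶜ < ε + δ} + volume.real (frontier Ω) +
        volume.real {z | z ∉ closure Ω ∧ infDist z (frontier Ω) < δ} := by
  set Bad : Set (Site 2) := {x ∈ meshVertices Ω δ | infDist (meshPoint δ x) Ωᶜ < ε} with hBad
  have hBfin : Bad.Finite := (meshVertices_finite hΩb hδ).subset fun x hx => hx.1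
  set T : Set ℂ := {z ∈ Ω | infDist z Ωᶜ < ε + δ}
  set T' : Set ℂ := {z | z ∉ closure Ω ∧ infDist z (frontier Ω) < δ}
  -- the small balls are pairwise disjoint
  have hdisj : (hBfin.toFinset : Set (Site 2)).PairwiseDisjoint
      fun x => ball (meshPoint δ x) (δ / 2) := by
    intro x _ y _ hxy
    refine Set.disjoint_left.2 fun p hpx hpy => ?_
    have h := le_dist_meshPoint_of_ne hδ hxy
    have : dist (meshPoint δ x) (meshPoint δ y) < δ :=
      calc dist (meshPoint δ x) (meshPoint δ y) ≤ dist (meshPoint δ x) p + dist p (meshPoint δ y) :=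
            dist_triangle _ _ _
        _ < δ / 2 + δ / 2 := add_lt_add (by rwa [dist_comm, ← mem_ball]) (mem_ball.1 hpy)
        _ = δ := by ring
    linarith
  -- and they lie in the union of the two collars and the frontier
  have hsub : (⋃ x ∈ hBfin.toFinset, ball (meshPoint δ x) (δ / 2)) ⊆ T ∪ frontier Ω ∪ T' := by
    intro p hp
    simp only [mem_iUnion, Finite.mem_toFinset, exists_prop] at hp
    obtain ⟨x, hx, hpx⟩ := hp
    have hxΩ : meshPoint δ x ∈ Ω := hx.1
    have hpx' : dist p (meshPoint δ x) < δ / 2 := mem_ball.1 hpx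
    by_cases hpΩ : p ∈ Ω
    · refine Or.inl (Or.inl ⟨hpΩ, ?_⟩)
      have := infDist_le_infDist_add_dist (x := p) (y := meshPoint δ x) (s := Ωᶜ)
      linarith [hx.2]
    by_cases hpc : p ∈ closure Ω
    · exact Or.inl (Or.inr ⟨hpc, by rwa [hΩo.interior_eq]⟩)
    refine Or.inr ⟨hpc, ?_⟩
    -- the segment from `δx ∈ Ω` to `p ∉ Ω` meets `∂Ω` (cf. `exists_mem_segment_frontier` in
    -- `Percolation/BoxCrossingProofs.lean`, not imported here)
    obtain ⟨q, hq, hqf⟩ : ∃ q ∈ segment ℝ (meshPoint δ x) p, q ∈ frontier Ω := by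
      by_contra! hcon
      refine hpΩ ((convex_segment (meshPoint δ x) p).isPreconnected.subset_of_closure_inter_subset
        hΩo ⟨meshPoint δ x, left_mem_segment ℝ _ _, hxΩ⟩ ?_ (right_mem_segment ℝ _ _))
      rintro w ⟨hwc, hws⟩
      by_contra hw
      exact hcon w hws ⟨hwc, by rwa [hΩo.interior_eq]⟩
    have hqp : dist q p ≤ dist (meshPoint δ x) p := by
      have := dist_add_dist_of_mem_segment hq
      linarith [dist_nonneg (x := meshPoint δ x) (y := q)]
    calc infDist p (frontier Ω) ≤ dist p q := infDist_le_dist_of_mem hqf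
      _ ≤ dist (meshPoint δ x) p := by rw [dist_comm]; exact hqp
      _ < δ / 2 := by rwa [dist_comm]
      _ < δ := by linarith
  -- the union of the collars and the frontier is bounded, hence of finite area
  have hTb : Bornology.IsBounded (T ∪ frontier Ω ∪ T') := by
    have hT'sub : T' ⊆ thickening δ (frontier Ω) := fun z hz =>
      (mem_thickening_iff_infDist_lt hfne).2 hz.2
    exact ((hΩb.subset fun z hz => hz.1).union (hΩb.closure.subset frontier_subset_closure)).union
      ((hΩb.closure.subset frontier_subset_closure).thickening.subset hT'sub)
  calc (Bad.ncard : ℝ) * ((δ / 2) ^ 2 * volume.real (ball (0 : ℂ) 1))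
      = ∑ x ∈ hBfin.toFinset, volume.real (ball (meshPoint δ x) (δ / 2)) := by
        rw [Set.ncard_eq_toFinset_card Bad hBfin, ← nsmul_eq_mul, ← Finset.sum_const]
        refine Finset.sum_congr rfl fun x _ => ?_
        rw [← Measure.addHaar_real_closedBall_eq_addHaar_real_ball volume (meshPoint δ x) (δ / 2),
          Measure.addHaar_real_closedBall volume _ (by positivity : (0 : ℝ) ≤ δ / 2),
          Complex.finrank_real_complex]
    _ = volume.real (⋃ x ∈ hBfin.toFinset, ball (meshPoint δ x) (δ / 2)) :=
        (measureReal_biUnion_finset hdisj (fun _ _ => measurableSet_ball)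
          (fun _ _ => measure_ball_lt_top.ne)).symm
    _ ≤ volume.real (T ∪ frontier Ω ∪ T') := measureReal_mono hsub hTb.measure_lt_top.ne
    _ ≤ volume.real (T ∪ frontier Ω) + volume.real T' := measureReal_union_le _ _
    _ ≤ volume.real T + volume.real (frontier Ω) + volume.real T' := by
        linarith [measureReal_union_le (μ := volume) T (frontier Ω)]

/-! ### Main theorem: the largest mesh component is the bulk -/

/-- **The largest mesh component is the bulk** (domains with Lebesgue-null boundary). Let
`Ω ⊆ ℂ` be open, bounded and connected with `area (∂Ω) = 0`, and let `K ⊆ Ω` be compact. Then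
for all sufficiently small mesh `δ > 0`:
* every lattice point of `δℤ²` whose mesh point lies in `K` belongs to the discrete domain
  `Ω_δ = meshDomain Ω δ` (the union of the connected components of maximal cardinality of the
  mesh graph on `Ω ∩ δℤ²`), and
* `Ω_δ` is a single connected component of that mesh graph (any two of its vertices are joined).

Proof: all lattice points at distance `≥ ε` from `Ωᶜ` lie in one component `B` (bulk
neighbourhood + staircase lemma) and there are `≥ (area Ω - o(1)) / area B(0, δ)` of them, while
all remaining mesh vertices lie within `ε` of `∂Ω`, and disjoint `δ/2`-balls about them fit into
the union of the inner collar of width `2ε`, `∂Ω` (null), and the outer collar of width `δ`, of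
total area `o(1)` as `ε, δ → 0`; so every other component is strictly smaller than `B`.
(For general Jordan domains with boundary of positive area the conclusion is not claimed.)
[folklore] -/
theorem exists_forall_mem_meshDomain_and_reachable {Ω : Set ℂ} (hΩo : IsOpen Ω)
    (hΩb : Bornology.IsBounded Ω) (hΩc : IsConnected Ω) (hΩf : volume (frontier Ω) = 0)
    {K : Set ℂ} (hK : IsCompact K) (hKΩ : K ⊆ Ω) :
    ∃ δ₀ > 0, ∀ δ, 0 < δ → δ < δ₀ →
      (∀ x : Site 2, meshPoint δ x ∈ K → x ∈ meshDomain Ω δ) ∧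
      (∀ x ∈ meshDomain Ω δ, ∀ y ∈ meshDomain Ω δ,
        ∃ (hx : x ∈ meshVertices Ω δ) (hy : y ∈ meshVertices Ω δ),
          (meshVertexGraph Ω δ).Reachable ⟨x, hx⟩ ⟨y, hy⟩) := by
  classical
  -- basic facts about `Ω`
  have hΩne : Ω.Nonempty := hΩc.nonempty
  have hΩuniv : Ω ≠ univ := fun h => NormedSpace.unbounded_univ ℝ ℂ (h ▸ hΩb)
  have hne : Ωᶜ.Nonempty := nonempty_compl.2 hΩuniv
  have hfne : (frontier Ω).Nonempty := nonempty_frontier_iff.2 ⟨hΩne, hΩuniv⟩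
  set v : ℝ := volume.real (ball (0 : ℂ) 1) with hv_def
  have hv : 0 < v :=
    ENNReal.toReal_pos (measure_ball_pos volume (0 : ℂ) one_pos).ne' measure_ball_lt_top.ne
  set m : ℝ := volume.real Ω with hm_def
  have hm : 0 < m := ENNReal.toReal_pos (hΩo.measure_pos volume hΩne).ne' hΩb.measure_lt_top.ne
  set η : ℝ := m / 10 with hη_def
  have hη : 0 < η := by positivity
  -- collars of small area
  obtain ⟨r₁, hr₁, hT⟩ := exists_pos_volume_real_innerCollar_lt hΩo hΩb hne hη
  obtain ⟨r₂, hr₂, hT'⟩ := exists_pos_volume_real_outerCollar_lt hΩb hfne hη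
  set ε : ℝ := r₁ / 2 with hε_def
  have hε : 0 < ε := by positivity
  -- the big compact `{ε ≤ infDist · Ωᶜ}` and the bulk neighbourhood `V` of `K ∪ Kbig`
  set Kbig : Set ℂ := {z | ε ≤ infDist z Ωᶜ} with hKbig_def
  have hKbigΩ : Kbig ⊆ Ω := fun z hz => by
    by_contra h
    have : infDist z Ωᶜ = 0 := infDist_zero_of_mem h
    have hz' : ε ≤ infDist z Ωᶜ := hz
    linarith
  have hKbigc : IsCompact Kbig :=
    Metric.isCompact_of_isClosed_isBounded (isClosed_le continuous_const (continuous_infDist_pt _))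
      (hΩb.subset hKbigΩ)
  obtain ⟨V, -, hVc, hKV, -, ρ, hρ, hVρ⟩ :=
    exists_isOpen_isPreconnected_bulk hΩo hΩc hne (hK.union hKbigc) (union_subset hKΩ hKbigΩ)
  have hVΩ : ∀ w ∈ V, ball w ρ ⊆ Ω := fun w hw =>
    (ball_subset_ball (hVρ w hw).le).trans ball_infDist_compl_subset
  -- the threshold
  refine ⟨min (ρ / 3) (min ε r₂), by positivity, fun δ hδ hδlt => ?_⟩
  have hδρ : 3 * δ ≤ ρ := by
    have := hδlt.le.trans (min_le_left _ _); linarith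
  have hδε : δ ≤ ε := hδlt.le.trans ((min_le_right _ _).trans (min_le_left _ _))
  have hδr₂ : δ ≤ r₂ := hδlt.le.trans ((min_le_right _ _).trans (min_le_right _ _))
  set G := meshVertexGraph Ω δ with hG_def
  set P : Set (Site 2) := {x | meshPoint δ x ∈ Ω ∧ ε ≤ infDist (meshPoint δ x) Ωᶜ} with hP_def
  set Bad : Set (Site 2) := {x ∈ meshVertices Ω δ | infDist (meshPoint δ x) Ωᶜ < ε} with hBad_def
  have hfinV : (meshVertices Ω δ).Finite := meshVertices_finite hΩb hδ
  -- the two counts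
  have hL := volume_real_le_ncard_mul hΩb hδ hδε
  have hU := ncard_mul_le_volume_real hΩo hΩb hfne hδ (ε := ε)
  have hfr : volume.real (frontier Ω) = 0 := by simp [measureReal_def, hΩf]
  have hTmono : volume.real {z ∈ Ω | infDist z Ωᶜ < ε + δ} ≤
      volume.real {z ∈ Ω | infDist z Ωᶜ < r₁} :=
    measureReal_mono (fun z hz => ⟨hz.1, hz.2.trans_le (by linarith)⟩)
      (hΩb.subset fun z hz => hz.1).measure_lt_top.ne
  have hT'mono : volume.real {z | z ∉ closure Ω ∧ infDist z (frontier Ω) < δ} ≤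
      volume.real {z | z ∉ closure Ω ∧ infDist z (frontier Ω) < r₂} := by
    refine measureReal_mono (fun z hz => ⟨hz.1, hz.2.trans_le hδr₂⟩) ?_
    have hsub : {z | z ∉ closure Ω ∧ infDist z (frontier Ω) < r₂} ⊆ thickening r₂ (frontier Ω) :=
      fun z hz => (mem_thickening_iff_infDist_lt hfne).2 hz.2
    exact ((hΩb.closure.subset frontier_subset_closure).thickening.subset hsub).measure_lt_top.ne
  have hsplit : m ≤ volume.real {z ∈ Ω | 2 * ε ≤ infDist z Ωᶜ} +
      volume.real {z ∈ Ω | infDist z Ωᶜ < r₁} := by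
    have hcov : Ω ⊆ {z ∈ Ω | 2 * ε ≤ infDist z Ωᶜ} ∪ {z ∈ Ω | infDist z Ωᶜ < r₁} := by
      intro z hz
      rcases le_or_gt (2 * ε) (infDist z Ωᶜ) with h | h
      · exact Or.inl ⟨hz, h⟩
      · exact Or.inr ⟨hz, by linarith⟩
    calc m ≤ volume.real ({z ∈ Ω | 2 * ε ≤ infDist z Ωᶜ} ∪ {z ∈ Ω | infDist z Ωᶜ < r₁}) :=
          measureReal_mono hcov ((hΩb.subset (union_subset (fun z hz => hz.1)
            (fun z hz => hz.1))).measure_lt_top.ne)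
      _ ≤ _ := measureReal_union_le _ _
  -- hence `#Bad < #P`
  have hcount : Bad.ncard < P.ncard := by
    have h1 : m - η ≤ (P.ncard : ℝ) * (δ ^ 2 * v) := by linarith
    have h2 : (Bad.ncard : ℝ) * (δ ^ 2 * v) ≤ 8 * η := by
      have h3 : (Bad.ncard : ℝ) * ((δ / 2) ^ 2 * v) ≤ 2 * η := by linarith
      have h4 : (Bad.ncard : ℝ) * (δ ^ 2 * v) = 4 * ((Bad.ncard : ℝ) * ((δ / 2) ^ 2 * v)) := by
        ring
      linarith
    have hpos : 0 < δ ^ 2 * v := by positivity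
    have h5 : (Bad.ncard : ℝ) * (δ ^ 2 * v) < (P.ncard : ℝ) * (δ ^ 2 * v) := by
      have : 8 * η < m - η := by rw [hη_def]; linarith
      linarith
    exact_mod_cast lt_of_mul_lt_mul_right h5 hpos.le
  -- the bulk component `B`
  obtain ⟨x₀, hx₀⟩ : P.Nonempty := nonempty_of_ncard_ne_zero (by omega)
  have hPV : ∀ x ∈ P, meshPoint δ x ∈ V := fun x hx => hKV (Or.inr hx.2)
  have hx₀Ω : x₀ ∈ meshVertices Ω δ := hx₀.1
  set B : G.ConnectedComponent := G.connectedComponentMk ⟨x₀, hx₀Ω⟩ with hB_def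
  have hVB : ∀ x, meshPoint δ x ∈ V →
      ∃ hx : x ∈ meshVertices Ω δ, G.connectedComponentMk ⟨x, hx⟩ = B := by
    intro x hx
    obtain ⟨hx', hx₀', hr⟩ :=
      meshVertexGraph_reachable_of_mem_bulk hδ hδρ hVc hVΩ hx (hPV x₀ hx₀)
    exact ⟨hx', SimpleGraph.ConnectedComponent.sound hr⟩
  -- points of any other component are `Bad`, points of `P` are in `B`
  have hCbad : ∀ C : G.ConnectedComponent, C ≠ B → Subtype.val '' C.supp ⊆ Bad := by
    rintro C hCB _ ⟨⟨x, hxΩ⟩, hxC, rfl⟩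
    refine ⟨hxΩ, ?_⟩
    by_contra hlt
    have hxP : x ∈ P := ⟨hxΩ, not_lt.1 hlt⟩
    obtain ⟨hx', hxB⟩ := hVB x (hPV x hxP)
    rw [SimpleGraph.ConnectedComponent.mem_supp_iff] at hxC
    exact hCB (hxC.symm.trans hxB)
  have hPB : P ⊆ Subtype.val '' B.supp := fun x hx => by
    obtain ⟨hx', hxB⟩ := hVB x (hPV x hx)
    exact ⟨⟨x, hx'⟩, (SimpleGraph.ConnectedComponent.mem_supp_iff _ _).2 hxB, rfl⟩
  have hfinB : (Subtype.val '' B.supp).Finite :=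
    hfinV.subset (by rintro _ ⟨y, -, rfl⟩; exact y.2)
  have hBadfin : Bad.Finite := hfinV.subset fun x hx => hx.1
  have hcardC : ∀ C : G.ConnectedComponent, C ≠ B → C.supp.ncard < B.supp.ncard := by
    intro C hCB
    rw [← ncard_image_of_injective C.supp Subtype.val_injective,
      ← ncard_image_of_injective B.supp Subtype.val_injective]
    calc (Subtype.val '' C.supp).ncard ≤ Bad.ncard := ncard_le_ncard (hCbad C hCB) hBadfin
      _ < P.ncard := hcount
      _ ≤ (Subtype.val '' B.supp).ncard := ncard_le_ncard hPB hfinB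
  -- so `Ω_δ` is exactly the set of points of `B`
  have hdom : meshDomain Ω δ = Subtype.val '' B.supp := by
    ext x
    simp only [meshDomain, mem_iUnion, mem_image]
    constructor
    · rintro ⟨C, hCmax, y, hyC, rfl⟩
      have hCB : C = B := by
        by_contra hCB
        exact (hcardC C hCB).not_ge (hCmax B)
      subst hCB
      exact ⟨y, hyC, rfl⟩
    · rintro ⟨y, hyB, rfl⟩
      refine ⟨B, fun C' => ?_, y, hyB, rfl⟩
      by_cases hC'B : C' = B
      · rw [hC'B]
      · exact (hcardC C' hC'B).le
  refine ⟨fun x hxK => ?_, fun x hx y hy => ?_⟩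
  · rw [hdom]
    obtain ⟨hx', hxB⟩ := hVB x (hKV (Or.inl hxK))
    exact ⟨⟨x, hx'⟩, (SimpleGraph.ConnectedComponent.mem_supp_iff _ _).2 hxB, rfl⟩
  · rw [hdom] at hx hy
    obtain ⟨⟨x', hx'⟩, hxB, rfl⟩ := hx
    obtain ⟨⟨y', hy'⟩, hyB, rfl⟩ := hy
    refine ⟨hx', hy', ?_⟩
    rw [SimpleGraph.ConnectedComponent.mem_supp_iff] at hxB hyB
    exact SimpleGraph.ConnectedComponent.exact (hxB.trans hyB.symm)

/-- `𝓝[>] 0` phrasing of `exists_forall_mem_meshDomain_and_reachable`: for all sufficiently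
small mesh, the lattice points of a compact `K ⊆ Ω` belong to `Ω_δ` and `Ω_δ` is connected in
the mesh graph (open bounded connected `Ω` with Lebesgue-null frontier). [folklore] -/
theorem eventually_forall_mem_meshDomain_and_reachable {Ω : Set ℂ} (hΩo : IsOpen Ω)
    (hΩb : Bornology.IsBounded Ω) (hΩc : IsConnected Ω) (hΩf : volume (frontier Ω) = 0)
    {K : Set ℂ} (hK : IsCompact K) (hKΩ : K ⊆ Ω) :
    ∀ᶠ δ in 𝓝[>] (0 : ℝ),
      (∀ x : Site 2, meshPoint δ x ∈ K → x ∈ meshDomain Ω δ) ∧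
      (∀ x ∈ meshDomain Ω δ, ∀ y ∈ meshDomain Ω δ,
        ∃ (hx : x ∈ meshVertices Ω δ) (hy : y ∈ meshVertices Ω δ),
          (meshVertexGraph Ω δ).Reachable ⟨x, hx⟩ ⟨y, hy⟩) := by
  obtain ⟨δ₀, hδ₀, h⟩ := exists_forall_mem_meshDomain_and_reachable hΩo hΩb hΩc hΩf hK hKΩ
  filter_upwards [Ioo_mem_nhdsGT hδ₀] with δ hδ
  exact h δ hδ.1 hδ.2

/-- Under the same hypotheses, `Ω_δ` is closed under mesh-graph paths: a mesh vertex joined in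
the mesh graph on mesh vertices to a lattice point of `K` belongs to `Ω_δ` (small mesh). This
is the form used when an open lattice path built inside `Ω` from RSW box crossings has to be
recognised as a path of the discrete domain `Ω_δ`. [folklore] -/
theorem eventually_mem_meshDomain_of_reachable {Ω : Set ℂ} (hΩo : IsOpen Ω)
    (hΩb : Bornology.IsBounded Ω) (hΩc : IsConnected Ω) (hΩf : volume (frontier Ω) = 0)
    {K : Set ℂ} (hK : IsCompact K) (hKΩ : K ⊆ Ω) :
    ∀ᶠ δ in 𝓝[>] (0 : ℝ), ∀ (x y : Site 2) (hx : x ∈ meshVertices Ω δ)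
      (hy : y ∈ meshVertices Ω δ), meshPoint δ x ∈ K →
        (meshVertexGraph Ω δ).Reachable ⟨x, hx⟩ ⟨y, hy⟩ → y ∈ meshDomain Ω δ := by
  filter_upwards [eventually_forall_mem_meshDomain_and_reachable hΩo hΩb hΩc hΩf hK hKΩ]
    with δ hδ x y hx hy hxK hr
  have hxD := hδ.1 x hxK
  simp only [meshDomain, mem_iUnion, mem_image] at hxD ⊢
  obtain ⟨C, hC, x', hx'C, hx'x⟩ := hxD
  refine ⟨C, hC, ⟨y, hy⟩, ?_, rfl⟩
  rw [SimpleGraph.ConnectedComponent.mem_supp_iff] at hx'C ⊢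
  rw [← hx'C]
  have hxx' : (⟨x, hx⟩ : meshVertices Ω δ) = x' := Subtype.ext hx'x.symm
  exact SimpleGraph.ConnectedComponent.sound (hxx' ▸ hr.symm)

end

end Literature.Probability.LatticeModels

/-! ### Jordan domains with Lebesgue-null boundary curve -/

namespace Literature.Probability.RandomPlanarGeometry.JordanDomain

open Set Metric MeasureTheory Filter Topology LatticeModels

/-- For a Jordan domain `D` whose boundary curve has zero area (e.g. rectifiable or piecewise
smooth boundaries, quasicircles) and a compact `K ⊆ D`: for all small mesh `δ`, the lattice
points of `K` lie in the discrete domain `D_δ = meshDomain D.carrier δ`, which is a single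
mesh component. [folklore] -/
theorem eventually_forall_mem_meshDomain (D : JordanDomain)
    (hD : volume (frontier D.carrier) = 0) {K : Set ℂ} (hK : IsCompact K)
    (hKD : K ⊆ D.carrier) :
    ∀ᶠ δ in 𝓝[>] (0 : ℝ),
      (∀ x : Site 2, meshPoint δ x ∈ K → x ∈ meshDomain D.carrier δ) ∧
      (∀ x ∈ meshDomain D.carrier δ, ∀ y ∈ meshDomain D.carrier δ,
        ∃ (hx : x ∈ meshVertices D.carrier δ) (hy : y ∈ meshVertices D.carrier δ),
          (meshVertexGraph D.carrier δ).Reachable ⟨x, hx⟩ ⟨y, hy⟩) :=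
  eventually_forall_mem_meshDomain_and_reachable D.isOpen D.isBounded D.isConnected hD hK hKD

end Literature.Probability.RandomPlanarGeometry.JordanDomain
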